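import Summits.KontsevichZagierPeriods.Zeta5Search.Barrier.ConeGammaNCap5
import Summits.KontsevichZagierPeriods.Zeta5Search.Barrier.ConeGammaSepMajorantKernel

/-!
# ζ(5) search — BARRIER: the separable integer majorants F7 / F6 of the saving step function are theorems on `ℝ⁸`

HONEST FRAMING (cell `pub-zeta5`): systematic search; no irrationality claim unless kernel-certified. MODEL objects under
Brown–Zudilin's (28)+(30) accounting ([BZ22] = arXiv:2210.03391): inequalities for BZ's OWN saving step function
`𝒩 = torusN` (BZ (29)–(30), `ConeGammaTorus`) on all of `ℝ⁸` — bookkeeping about one step function; nothing here is a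
statement about the MODEL functional `Φ`'s values, any `γ`, S-E, (TD_A), C2, the cone's sup or `ζ(5)`; records in print
UNMOVED. Theory seat cert-2 g33 (item «SEP-MAJORANT KERNEL», INBOX plan 2026-08-27), making KERNEL THEOREMS of the two
integer separable majorants F7 / F6 that cert-2 g32 certified by an exhaustive exact integer check of the 92,897,280
(cell, vertex) pairs of the type-B₈ arrangement (memo `cert-2/g32/SEP-MAJORANT.md` §0 (R1), BARRIER-PLAN ADD. 38 (c)) —
here with NO cell enumeration: the rank form of `ConeGammaNCap5` + the finite table of `ConeGammaSepMajorantKernel`.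

THE FAMILY. With `x = fract θ`, `H(i,j) = [x_i + x_j ≥ 1]` (`heavyInd`), `U(j) = [x_j > x₀]` (`highInd`), the W-form
`𝒩 = max_σ W(σ̃P₀) − W(P₀)` (`torusTerm_eq_wForm`): for every pair of distinct vertices `v ≠ w` of `{1..7}`

  `G(v,w):  max_σ W(σ̃P₀) ≤ 1 − [x₀ + x_v ≥ 1] + U(v) + H(v,w) + #{i ∉ {v,w} | x_i > x_v} + deg_H(v)`

(`torusN_le_sepMajorant`, 42 labelled members); F7 = `G(7,1) − W(P₀)` and F6 = `G(6,7) − W(P₀)` identically, and the two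
fractional-part forms of the memo are `torusN_le_F7` / `torusN_le_F6` (the linear parts cancel). PROOF: sort the weights
(`srt`, `rk`); `max_σ W` depends only on the threshold pattern and the top segment (`NCap5`); the right side depends on the
ranks `r, s` of `v, w`, the bit `A = [x₀ + x_v ≥ 1]` and the tie threshold `m = #{j | x_j ≤ x_v}` (`rk_lt_card_iff`: the
weights `≤ x_v` are exactly the `m` lowest ranks), and `x₀` forces the two consistency constraints of
`NCap.wVal_le_sepBound` (`A = 0 ⇒` heavy neighbours of `v` are high; `A = 1 ⇒` high vertices are heavy neighbours of `v`).

* `rk_srt`, `rk_lt_rk_of_xw_lt`, `xw_le_xw_of_rk_le`, `card_filter_rk_lt`, `rk_lt_card_iff`, `xw_srt_eq_of_tie` — ranks;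
* `wForm_add_le_sep` — the bound in the W-form for every relabelling `σ`; `wForm_liftPerm_one`;
* **`torusN_le_sepMajorant`** (bit form, all `v ≠ w`); `fract_add_eq_heavyInd`, `fract_sub_eq`,
  `fract_zero_sub_eq_highInd`; **`torusN_le_F7`**, **`torusN_le_F6`** (the memo's forms verbatim, `{·} = Int.fract`).
  Along the flow of a box direction `a`, `savingN a u = torusN (u • sParam a)` (`savingN_eq_torusN_of_BZBox`) transfers
  every bound to the saving exponent `N_a(u)`.
-/

noncomputable section

open Finset

namespace Summit.KontsevichZagierPeriods.Zeta5Search.Barrier.ConeGamma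

/-! ### Ranks versus weights -/

/-- The rank of a sorted position. -/
theorem rk_srt (θ : Fin 8 → ℝ) (q : Fin 7) : rk θ (srt θ q) = q := by
  simp [rk]

/-- A strictly smaller weight has a strictly smaller rank. -/
theorem rk_lt_rk_of_xw_lt (θ : Fin 8 → ℝ) {a b : Fin 7} (h : xw θ a < xw θ b) : rk θ a < rk θ b := by
  by_contra hle
  push Not at hle
  have := xw_srt_mono θ (p := ⟨rk θ b, rk_lt θ b⟩) (q := ⟨rk θ a, rk_lt θ a⟩) (Fin.mk_le_mk.mpr hle)
  rw [srt_rk, srt_rk] at this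
  linarith

/-- A smaller-or-equal rank has a smaller-or-equal weight. -/
theorem xw_le_xw_of_rk_le (θ : Fin 8 → ℝ) {a b : Fin 7} (h : rk θ a ≤ rk θ b) : xw θ a ≤ xw θ b := by
  have := xw_srt_mono θ (p := ⟨rk θ a, rk_lt θ a⟩) (q := ⟨rk θ b, rk_lt θ b⟩) (Fin.mk_le_mk.mpr h)
  rwa [srt_rk, srt_rk] at this

/-- `#{a | rk a < n} = n` for `n ≤ 7`. -/
theorem card_filter_rk_lt (θ : Fin 8 → ℝ) {n : ℕ} (hn : n ≤ 7) :
    (univ.filter fun a : Fin 7 => rk θ a < n).card = n := by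
  have e : (univ.filter fun a : Fin 7 => rk θ a < n) =
      (univ.filter fun q : Fin 7 => (q : ℕ) < n).map (srt θ).toEmbedding := by
    ext a
    simp only [mem_filter, mem_univ, true_and, mem_map, Equiv.coe_toEmbedding]
    constructor
    · intro h
      exact ⟨⟨rk θ a, rk_lt θ a⟩, h, srt_rk θ a⟩
    · rintro ⟨q, hq, rfl⟩
      rwa [rk_srt]
  rw [e, card_map]
  interval_cases n <;> decide

/-- **The tie threshold.** With `m = #{j | x_j ≤ x_v}`: `rk a < m ↔ x_a ≤ x_v` (the weights `≤ x_v` form the down-set of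
the `m` lowest ranks; the ranks in `(rk v, m)` are the weights tied with `x_v`). -/
theorem rk_lt_card_iff (θ : Fin 8 → ℝ) (v a : Fin 7) :
    rk θ a < (univ.filter fun j : Fin 7 => xw θ j ≤ xw θ v).card ↔ xw θ a ≤ xw θ v := by
  constructor
  · intro h
    by_contra hlt
    push Not at hlt
    have hsub : (univ.filter fun j : Fin 7 => xw θ j ≤ xw θ v) ⊆ univ.filter fun j : Fin 7 => rk θ j < rk θ a := by
      intro j hj
      simp only [mem_filter, mem_univ, true_and] at hj ⊢
      exact rk_lt_rk_of_xw_lt θ (lt_of_le_of_lt hj hlt)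
    have := card_le_card hsub
    rw [card_filter_rk_lt θ (rk_lt θ a).le] at this
    omega
  · intro h
    by_contra hge
    push Not at hge
    have hsub : (univ.filter fun j : Fin 7 => rk θ j < rk θ a + 1) ⊆ univ.filter fun j : Fin 7 => xw θ j ≤ xw θ v := by
      intro j hj
      simp only [mem_filter, mem_univ, true_and] at hj ⊢
      exact le_trans (xw_le_xw_of_rk_le θ (Nat.lt_succ_iff.mp hj)) h
    have := card_le_card hsub
    rw [card_filter_rk_lt θ (by have := rk_lt θ a; omega)] at this
    omega

/-- A rank strictly between `rk v` and the tie threshold carries the weight `x_v`. -/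
theorem xw_srt_eq_of_tie (θ : Fin 8 → ℝ) (v : Fin 7) {q : ℕ} (hq : q < 7) (h1 : rk θ v < q)
    (h2 : q < (univ.filter fun j : Fin 7 => xw θ j ≤ xw θ v).card) : xw θ (srt θ ⟨q, hq⟩) = xw θ v := by
  apply le_antisymm
  · exact (rk_lt_card_iff θ v (srt θ ⟨q, hq⟩)).mp (by rwa [rk_srt])
  · have := xw_srt_mono θ (p := ⟨rk θ v, rk_lt θ v⟩) (q := ⟨q, hq⟩) (Fin.mk_le_mk.mpr h1.le)
    rwa [srt_rk] at this

/-! ### The separable bound in the W-form (all `σ`, all labelled pairs `v ≠ w`) -/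

/-- `−⌊a − b⌋ = [a < b]` for `a, b ∈ [0,1)` (here: fractional parts). -/
theorem neg_floor_fract_sub (θ : Fin 8 → ℝ) (p q : Fin 8) :
    -⌊Int.fract (θ p) - Int.fract (θ q)⌋ = if Int.fract (θ p) < Int.fract (θ q) then (1 : ℤ) else 0 := by
  have h0a := Int.fract_nonneg (θ p); have h1a := Int.fract_lt_one (θ p)
  have h0b := Int.fract_nonneg (θ q); have h1b := Int.fract_lt_one (θ q)
  split_ifs with h
  · have : ⌊Int.fract (θ p) - Int.fract (θ q)⌋ = -1 := by
      rw [Int.floor_eq_iff]; push_cast; constructor <;> linarith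
    rw [this]; rfl
  · have : ⌊Int.fract (θ p) - Int.fract (θ q)⌋ = 0 := by
      rw [Int.floor_eq_iff]; push_cast; constructor <;> linarith
    rw [this]; rfl

/-- `#(filter p [0..n)) = Σ_{q<n} [p q]`. -/
theorem length_filter_range_eq_sum (p : ℕ → Bool) (n : ℕ) :
    ((List.range n).filter p).length = ∑ q ∈ Finset.range n, if p q = true then 1 else 0 := by
  induction n with
  | zero => simp
  | succ n ih =>
    rw [List.range_succ, List.filter_append, List.length_append, ih, Finset.sum_range_succ]
    congr 1
    by_cases h : p n = true
    · simp [h]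
    · simp [h]

/-- **THE SEPARABLE BOUND, W-FORM.** For every relabelling `σ` and every labelled pair of distinct vertices `v ≠ w` of
`{1..7}` (as `Fin 7`, vertex `j+1 ↔ j`), with `x = fract θ`, `H(i,j) = heavyInd`, `U(j) = highInd`:
`W(σ̃P₀) + [x₀ + x_v ≥ 1] ≤ 1 + U(v) + H(v,w) + #{i ∉ {v,w} | x_i > x_v} + deg_H(v)`. -/
theorem wForm_add_le_sep (θ : Fin 8 → ℝ) (σ : Equiv.Perm (Fin 7)) {v w : Fin 7} (hvw : v ≠ w) :
    wForm θ (liftPerm σ) + heavyInd θ 0 v.succ ≤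
      1 + highInd θ v.succ + heavyInd θ v.succ w.succ +
        (∑ i : Fin 7, if i = v ∨ i = w then (0 : ℤ) else -⌊Int.fract (θ v.succ) - Int.fract (θ i.succ)⌋) +
        ∑ j : Fin 7, if j = v then (0 : ℤ) else heavyInd θ v.succ j.succ := by
  -- the abstract bound at `r = rk v`, `s = rk w`, the tie threshold `m`, the bit `A = [1 ≤ x₀ + x_v]`
  set m := (univ.filter fun j : Fin 7 => xw θ j ≤ xw θ v).card with hm
  have hm7 : m ≤ 7 := le_trans (card_filter_le _ _) (by simp)
  have hrm : rk θ v < m := (rk_lt_card_iff θ v v).mpr le_rfl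
  have hrs : rk θ v ≠ rk θ w := by
    intro h
    have : (srt θ).symm v = (srt θ).symm w := Fin.ext h
    exact hvw (by simpa using this)
  set A : Bool := decide (1 ≤ Int.fract (θ 0) + xw θ v) with hA
  have hx0 := Int.fract_nonneg (θ 0); have hx0' := Int.fract_lt_one (θ 0)
  have hC2 : A = false → ∀ q, q < 7 → q ≠ rk θ v → hvN θ (rk θ v) q = true → hiN θ q = true := by
    intro hAf q hq _ hh
    have hA' : Int.fract (θ 0) + xw θ v < 1 := by
      have := (decide_eq_false_iff_not).mp hAf; linarith
    unfold hvN at hh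
    rw [dif_pos (rk_lt θ v), dif_pos hq, srt_rk, decide_eq_true_eq] at hh
    unfold hiN
    rw [dif_pos hq, decide_eq_true_eq]
    linarith
  have hC3 : A = true → ∀ q, q < 7 → q ≠ rk θ v → hiN θ q = true → hvN θ (rk θ v) q = true := by
    intro hAt q hq _ hh
    have hA' : 1 ≤ Int.fract (θ 0) + xw θ v := of_decide_eq_true hAt
    unfold hiN at hh
    rw [dif_pos hq, decide_eq_true_eq] at hh
    unfold hvN
    rw [dif_pos (rk_lt θ v), dif_pos hq, srt_rk, decide_eq_true_eq]
    linarith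
  have htie : ∀ q, q < 7 → rk θ v < q → q < m →
      hiN θ q = hiN θ (rk θ v) ∧ ∀ p, p < 7 → p ≠ q → p ≠ rk θ v → hvN θ q p = hvN θ (rk θ v) p := by
    intro q hq h1 h2
    have he := xw_srt_eq_of_tie θ v hq h1 h2
    refine ⟨?_, fun p hp _ _ => ?_⟩
    · unfold hiN
      rw [dif_pos hq, dif_pos (rk_lt θ v), srt_rk, he]
    · unfold hvN
      rw [dif_pos hq, dif_pos hp, dif_pos (rk_lt θ v), dif_pos hp, srt_rk, he]
  have key := NCap.wVal_le_sepBound (hvN θ) (hiN θ) (hvN_symm θ) (hvN_row θ) (hvN_col θ) (hiN_mono θ)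
    (rk_lt θ v) (rk_lt θ w) hm7 hrs hrm hC2 hC3 htie (rkPath_perm_range θ σ)
  -- translate every term
  have e1 : wForm θ (liftPerm σ) = (NCap.wVal (hvN θ) (hiN θ) (rkPath θ σ) : ℤ) := wForm_eq_wVal θ σ
  have e2 : heavyInd θ 0 v.succ = ((if A then 1 else 0 : ℕ) : ℤ) := by
    rw [heavyInd_eq_ite, hA]
    by_cases h : 1 ≤ Int.fract (θ 0) + Int.fract (θ v.succ)
    · rw [if_pos h, decide_eq_true (by simpa [xw] using h)]; simp
    · rw [if_neg h, decide_eq_false (by simpa [xw] using h)]; simp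
  have e3 : highInd θ v.succ = ((if hiN θ (rk θ v) then 1 else 0 : ℕ) : ℤ) := highInd_eq_rank θ v
  have e4 : heavyInd θ v.succ w.succ = ((if hvN θ (rk θ v) (rk θ w) then 1 else 0 : ℕ) : ℤ) := heavyInd_eq_rank θ v w
  -- the degree
  have e5 : (∑ j : Fin 7, if j = v then (0 : ℤ) else heavyInd θ v.succ j.succ) = (NCap.hdeg (hvN θ) (rk θ v) : ℤ) := by
    have hre : (∑ j : Fin 7, if j = v then (0 : ℤ) else heavyInd θ v.succ j.succ) =
        ∑ q : Fin 7, if (q : ℕ) = rk θ v then (0 : ℤ) else ((if hvN θ (rk θ v) q then 1 else 0 : ℕ) : ℤ) := by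
      rw [← Equiv.sum_comp (srt θ)]
      refine Finset.sum_congr rfl fun q _ => ?_
      have hq : (srt θ q = v) ↔ ((q : ℕ) = rk θ v) := by
        constructor
        · rintro rfl; rw [rk_srt]
        · intro h
          have hq' : q = ⟨rk θ v, rk_lt θ v⟩ := Fin.ext h
          rw [hq', srt_rk]
      by_cases h : srt θ q = v
      · rw [if_pos h, if_pos (hq.mp h)]
      · rw [if_neg h, if_neg (fun h' => h (hq.mpr h')), heavyInd_eq_rank, rk_srt]
    rw [hre, Fin.sum_univ_eq_sum_range (fun q => if q = rk θ v then (0 : ℤ) else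
      ((if hvN θ (rk θ v) q then 1 else 0 : ℕ) : ℤ)) 7]
    unfold NCap.hdeg
    rw [length_filter_range_eq_sum]
    push_cast
    refine Finset.sum_congr rfl fun q _ => ?_
    by_cases h : q = rk θ v
    · simp [h]
    · by_cases h' : hvN θ (rk θ v) q = true
      · simp [h, h']
      · simp [h, h']
  -- the strict-above count
  have e6 : (∑ i : Fin 7, if i = v ∨ i = w then (0 : ℤ) else -⌊Int.fract (θ v.succ) - Int.fract (θ i.succ)⌋) +
      ((if m ≤ rk θ w then 1 else 0 : ℕ) : ℤ) + m = 7 := by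
    have hre : (∑ i : Fin 7, if i = v ∨ i = w then (0 : ℤ) else -⌊Int.fract (θ v.succ) - Int.fract (θ i.succ)⌋) =
        ∑ q : Fin 7, if (q : ℕ) = rk θ v ∨ (q : ℕ) = rk θ w then (0 : ℤ) else if m ≤ (q : ℕ) then 1 else 0 := by
      rw [← Equiv.sum_comp (srt θ)]
      refine Finset.sum_congr rfl fun q _ => ?_
      have hq : ∀ a : Fin 7, (srt θ q = a) ↔ ((q : ℕ) = rk θ a) := fun a => by
        constructor
        · rintro rfl; rw [rk_srt]
        · intro h
          have hq' : q = ⟨rk θ a, rk_lt θ a⟩ := Fin.ext h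
          rw [hq', srt_rk]
      by_cases h : srt θ q = v ∨ srt θ q = w
      · rw [if_pos h, if_pos (h.imp (hq v).mp (hq w).mp)]
      · rw [if_neg h, if_neg (fun h' => h (h'.imp (hq v).mpr (hq w).mpr)), neg_floor_fract_sub]
        have hiff : Int.fract (θ v.succ) < Int.fract (θ (srt θ q).succ) ↔ m ≤ (q : ℕ) := by
          have := rk_lt_card_iff θ v (srt θ q)
          rw [rk_srt] at this
          change xw θ v < xw θ (srt θ q) ↔ _
          rw [← not_le, ← this, not_lt]
        by_cases hh : m ≤ (q : ℕ)
        · rw [if_pos (hiff.mpr hh), if_pos hh]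
        · rw [if_neg (fun h' => hh (hiff.mp h')), if_neg hh]
    rw [hre, Fin.sum_univ_eq_sum_range (fun q => if q = rk θ v ∨ q = rk θ w then (0 : ℤ) else
      if m ≤ q then 1 else 0) 7]
    -- `∑_{q<7} (…) = (7 − m) − [m ≤ rk w]`
    have hsplit : ∀ q ∈ Finset.range 7, (if q = rk θ v ∨ q = rk θ w then (0 : ℤ) else if m ≤ q then 1 else 0) =
        (if m ≤ q then 1 else 0) - (if q = rk θ w then ((if m ≤ rk θ w then 1 else 0 : ℕ) : ℤ) else 0) := by
      intro q _
      by_cases h1 : q = rk θ v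
      · subst h1
        rw [if_pos (Or.inl rfl), if_neg (by omega), if_neg hrs]; simp
      · by_cases h2 : q = rk θ w
        · subst h2
          rw [if_pos (Or.inr rfl), if_pos rfl]; push_cast; ring
        · rw [if_neg (by tauto), if_neg h2]; ring
    rw [Finset.sum_congr rfl hsplit, Finset.sum_sub_distrib, Finset.sum_ite_eq' (Finset.range 7) (rk θ w),
      if_pos (Finset.mem_range.mpr (rk_lt θ w))]
    have hcount : (∑ q ∈ Finset.range 7, (if m ≤ q then (1 : ℤ) else 0)) + m = 7 := by
      interval_cases m <;> · simp only [Finset.sum_range_succ, Finset.sum_range_zero]; norm_num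
    omega
  have key' : (NCap.wVal (hvN θ) (hiN θ) (rkPath θ σ) : ℤ) + ((if A then 1 else 0 : ℕ) : ℤ) +
      ((if m ≤ rk θ w then 1 else 0 : ℕ) : ℤ) + (m : ℤ) ≤ 8 + ((if hiN θ (rk θ v) then 1 else 0 : ℕ) : ℤ) +
      (NCap.hdeg (hvN θ) (rk θ v) : ℤ) + ((if hvN θ (rk θ v) (rk θ w) then 1 else 0 : ℕ) : ℤ) := by
    exact_mod_cast key
  rw [e1, e2, e3, e4, e5]
  linarith [key', e6]


/-! ### The separable majorant family for `𝒩 = torusN` -/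

/-- `W(P₀)` for the identity relabelling: the reference path `3–5–4–6–1–7–2`. -/
theorem wForm_liftPerm_one (θ : Fin 8 → ℝ) :
    wForm θ (liftPerm (1 : Equiv.Perm (Fin 7))) = heavyInd θ 3 5 + heavyInd θ 4 6 + heavyInd θ 1 6 +
      heavyInd θ 1 7 + heavyInd θ 4 5 + heavyInd θ 2 7 + highInd θ 2 + highInd θ 3 := by
  have hid : (liftPerm (1 : Equiv.Perm (Fin 7)) : Fin 8 → Fin 8) = id := by
    ext i; refine Fin.cases ?_ (fun j => ?_) i <;> simp
  rw [hid]; rfl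

/-- **THE SEPARABLE MAJORANT FAMILY (bit form; 42 labelled members).** For every `θ ∈ ℝ⁸` and every labelled pair of
distinct vertices `v ≠ w` of `{1..7}` (as `Fin 7`, vertex `j+1 ↔ j`), with `x = fract θ`, `H(i,j) = [x_i + x_j ≥ 1]`,
`U(j) = [x_j > x₀]`:
`𝒩(θ) ≤ 1 − [x₀ + x_v ≥ 1] + U(v) + H(v,w) + #{i ∉ {v,w} | x_i > x_v} + deg_H(v) − W(P₀)`,
`W(P₀) = H(3,5) + H(4,6) + H(1,6) + H(1,7) + H(4,5) + H(2,7) + U(2) + U(3)` (cert-2 g32's F7 is `(v,w) = (7,1)`, F6 is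
`(6,7)`). -/
theorem torusN_le_sepMajorant (θ : Fin 8 → ℝ) {v w : Fin 7} (hvw : v ≠ w) :
    torusN θ ≤ 1 - heavyInd θ 0 v.succ + highInd θ v.succ + heavyInd θ v.succ w.succ +
        (∑ i : Fin 7, if i = v ∨ i = w then (0 : ℤ) else -⌊Int.fract (θ v.succ) - Int.fract (θ i.succ)⌋) +
        (∑ j : Fin 7, if j = v then (0 : ℤ) else heavyInd θ v.succ j.succ) -
      (heavyInd θ 3 5 + heavyInd θ 4 6 + heavyInd θ 1 6 + heavyInd θ 1 7 + heavyInd θ 4 5 + heavyInd θ 2 7 +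
        highInd θ 2 + highInd θ 3) := by
  unfold torusN
  refine Finset.sup'_le _ _ fun σ _ => ?_
  rw [torusTerm_eq_wForm, wForm_liftPerm_one]
  have h := wForm_add_le_sep θ σ hvw
  linarith

/-! ### The two members of record in fractional-part form (`cert-2/g32/SEP-MAJORANT.md` §0 (R1)) -/

/-- `{θ_i + θ_j} = x_i + x_j − H(i,j)`. -/
theorem fract_add_eq_heavyInd (θ : Fin 8 → ℝ) (i j : Fin 8) :
    Int.fract (θ i + θ j) = Int.fract (θ i) + Int.fract (θ j) - heavyInd θ i j := by
  have key : θ i + θ j = ((⌊θ i⌋ + ⌊θ j⌋ : ℤ) : ℝ) + (Int.fract (θ i) + Int.fract (θ j)) := by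
    have h1 := Int.floor_add_fract (θ i); have h2 := Int.floor_add_fract (θ j)
    push_cast; linarith
  unfold heavyInd Int.fract
  rw [key, Int.floor_intCast_add]
  push_cast
  unfold Int.fract
  ring

/-- `{θ_i − θ_j} = x_i − x_j − ⌊x_i − x_j⌋` (`= x_i − x_j + [x_i < x_j]`). -/
theorem fract_sub_eq (θ : Fin 8 → ℝ) (i j : Fin 8) :
    Int.fract (θ i - θ j) = Int.fract (θ i) - Int.fract (θ j) - ⌊Int.fract (θ i) - Int.fract (θ j)⌋ := by
  have key : θ i - θ j = ((⌊θ i⌋ - ⌊θ j⌋ : ℤ) : ℝ) + (Int.fract (θ i) - Int.fract (θ j)) := by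
    have h1 := Int.floor_add_fract (θ i); have h2 := Int.floor_add_fract (θ j)
    push_cast; linarith
  conv_lhs => rw [Int.fract, key, Int.floor_intCast_add]
  push_cast
  unfold Int.fract
  ring

/-- `{θ₀ − θ_j} = x₀ − x_j + U(j)`. -/
theorem fract_zero_sub_eq_highInd (θ : Fin 8 → ℝ) (j : Fin 8) :
    Int.fract (θ 0 - θ j) = Int.fract (θ 0) - Int.fract (θ j) + highInd θ j := by
  rw [fract_sub_eq]; unfold highInd; push_cast; ring

/-- **F7 (cert-2 g32, BARRIER-PLAN ADD. 38 (c)) IS A THEOREM on all of `ℝ⁸`:**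
`𝒩(θ) ≤ 1 + {θ₀+θ₇} + {θ₁+θ₆} + {θ₃+θ₅} + {θ₄+θ₅} + {θ₄+θ₆} + {θ₀−θ₇} + Σ_{i=2..6} {θ₇−θ_i}
 − {θ₁+θ₇} − {θ₃+θ₇} − {θ₄+θ₇} − {θ₅+θ₇} − {θ₆+θ₇} − {θ₀−θ₂} − {θ₀−θ₃}` (`{·} = Int.fract`; member `(v,w) = (7,1)`). -/
theorem torusN_le_F7 (θ : Fin 8 → ℝ) :
    (torusN θ : ℝ) ≤ 1 + Int.fract (θ 0 + θ 7) + Int.fract (θ 1 + θ 6) + Int.fract (θ 3 + θ 5) +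
      Int.fract (θ 4 + θ 5) + Int.fract (θ 4 + θ 6) + Int.fract (θ 0 - θ 7) +
      (Int.fract (θ 7 - θ 2) + Int.fract (θ 7 - θ 3) + Int.fract (θ 7 - θ 4) + Int.fract (θ 7 - θ 5) +
        Int.fract (θ 7 - θ 6)) -
      Int.fract (θ 1 + θ 7) - Int.fract (θ 3 + θ 7) - Int.fract (θ 4 + θ 7) - Int.fract (θ 5 + θ 7) -
      Int.fract (θ 6 + θ 7) - Int.fract (θ 0 - θ 2) - Int.fract (θ 0 - θ 3) := by
  have h := torusN_le_sepMajorant θ (v := 6) (w := 0) (by decide)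
  simp only [Fin.sum_univ_seven, Fin.reduceSucc, Fin.reduceEq, Fin.isValue, or_self, or_true, or_false,
    if_true, if_false, zero_add, add_zero] at h
  have h' : (torusN θ : ℝ) ≤ ((1 - heavyInd θ 0 7 + highInd θ 7 + heavyInd θ 7 1 +
      (-⌊Int.fract (θ 7) - Int.fract (θ 2)⌋ + -⌊Int.fract (θ 7) - Int.fract (θ 3)⌋ +
        -⌊Int.fract (θ 7) - Int.fract (θ 4)⌋ + -⌊Int.fract (θ 7) - Int.fract (θ 5)⌋ +
        -⌊Int.fract (θ 7) - Int.fract (θ 6)⌋) +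
      (heavyInd θ 7 1 + heavyInd θ 7 2 + heavyInd θ 7 3 + heavyInd θ 7 4 + heavyInd θ 7 5 + heavyInd θ 7 6) -
      (heavyInd θ 3 5 + heavyInd θ 4 6 + heavyInd θ 1 6 + heavyInd θ 1 7 + heavyInd θ 4 5 + heavyInd θ 2 7 +
        highInd θ 2 + highInd θ 3) : ℤ) : ℝ) := by
    exact_mod_cast h
  push_cast at h'
  rw [heavyInd_comm θ 7 1, heavyInd_comm θ 7 2, heavyInd_comm θ 7 3, heavyInd_comm θ 7 4, heavyInd_comm θ 7 5,
    heavyInd_comm θ 7 6] at h'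
  rw [fract_add_eq_heavyInd θ 0 7, fract_add_eq_heavyInd θ 1 6, fract_add_eq_heavyInd θ 3 5,
    fract_add_eq_heavyInd θ 4 5, fract_add_eq_heavyInd θ 4 6, fract_zero_sub_eq_highInd θ 7,
    fract_sub_eq θ 7 2, fract_sub_eq θ 7 3, fract_sub_eq θ 7 4, fract_sub_eq θ 7 5, fract_sub_eq θ 7 6,
    fract_add_eq_heavyInd θ 1 7, fract_add_eq_heavyInd θ 3 7, fract_add_eq_heavyInd θ 4 7,
    fract_add_eq_heavyInd θ 5 7, fract_add_eq_heavyInd θ 6 7, fract_zero_sub_eq_highInd θ 2,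
    fract_zero_sub_eq_highInd θ 3]
  linarith

/-- **F6 (cert-2 g32, BARRIER-PLAN ADD. 38 (c)) IS A THEOREM on all of `ℝ⁸`:**
`𝒩(θ) ≤ 1 + {θ₀+θ₆} + {θ₁+θ₇} + {θ₂+θ₇} + {θ₃+θ₅} + {θ₄+θ₅} + {θ₀−θ₆} + Σ_{i=1..5} {θ₆−θ_i}
 − {θ₂+θ₆} − {θ₃+θ₆} − {θ₅+θ₆} − 2{θ₆+θ₇} − {θ₀−θ₂} − {θ₀−θ₃}` (`{·} = Int.fract`; member `(v,w) = (6,7)`). -/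
theorem torusN_le_F6 (θ : Fin 8 → ℝ) :
    (torusN θ : ℝ) ≤ 1 + Int.fract (θ 0 + θ 6) + Int.fract (θ 1 + θ 7) + Int.fract (θ 2 + θ 7) +
      Int.fract (θ 3 + θ 5) + Int.fract (θ 4 + θ 5) + Int.fract (θ 0 - θ 6) +
      (Int.fract (θ 6 - θ 1) + Int.fract (θ 6 - θ 2) + Int.fract (θ 6 - θ 3) + Int.fract (θ 6 - θ 4) +
        Int.fract (θ 6 - θ 5)) -
      Int.fract (θ 2 + θ 6) - Int.fract (θ 3 + θ 6) - Int.fract (θ 5 + θ 6) - 2 * Int.fract (θ 6 + θ 7) -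
      Int.fract (θ 0 - θ 2) - Int.fract (θ 0 - θ 3) := by
  have h := torusN_le_sepMajorant θ (v := 5) (w := 6) (by decide)
  simp only [Fin.sum_univ_seven, Fin.reduceSucc, Fin.reduceEq, Fin.isValue, or_self, or_true, or_false,
    if_true, if_false, add_zero] at h
  have h' : (torusN θ : ℝ) ≤ ((1 - heavyInd θ 0 6 + highInd θ 6 + heavyInd θ 6 7 +
      (-⌊Int.fract (θ 6) - Int.fract (θ 1)⌋ + -⌊Int.fract (θ 6) - Int.fract (θ 2)⌋ +
        -⌊Int.fract (θ 6) - Int.fract (θ 3)⌋ + -⌊Int.fract (θ 6) - Int.fract (θ 4)⌋ +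
        -⌊Int.fract (θ 6) - Int.fract (θ 5)⌋) +
      (heavyInd θ 6 1 + heavyInd θ 6 2 + heavyInd θ 6 3 + heavyInd θ 6 4 + heavyInd θ 6 5 + heavyInd θ 6 7) -
      (heavyInd θ 3 5 + heavyInd θ 4 6 + heavyInd θ 1 6 + heavyInd θ 1 7 + heavyInd θ 4 5 + heavyInd θ 2 7 +
        highInd θ 2 + highInd θ 3) : ℤ) : ℝ) := by
    exact_mod_cast h
  push_cast at h'
  rw [heavyInd_comm θ 6 1, heavyInd_comm θ 6 2, heavyInd_comm θ 6 3, heavyInd_comm θ 6 4, heavyInd_comm θ 6 5]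
    at h'
  rw [fract_add_eq_heavyInd θ 0 6, fract_add_eq_heavyInd θ 1 7, fract_add_eq_heavyInd θ 2 7,
    fract_add_eq_heavyInd θ 3 5, fract_add_eq_heavyInd θ 4 5, fract_zero_sub_eq_highInd θ 6,
    fract_sub_eq θ 6 1, fract_sub_eq θ 6 2, fract_sub_eq θ 6 3, fract_sub_eq θ 6 4, fract_sub_eq θ 6 5,
    fract_add_eq_heavyInd θ 2 6, fract_add_eq_heavyInd θ 3 6, fract_add_eq_heavyInd θ 5 6,
    fract_add_eq_heavyInd θ 6 7, fract_zero_sub_eq_highInd θ 2, fract_zero_sub_eq_highInd θ 3]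
  linarith

end Summit.KontsevichZagierPeriods.Zeta5Search.Barrier.ConeGamma

end
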